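import Summits.CriticalPhenomena.PercolationContinuityZ3.Theorems.Transplant.HexShadowVRouteData
import Summits.CriticalPhenomena.PercolationContinuityZ3.Theorems.Transplant.HexShadowVSurgeryAtt
import Summits.CriticalPhenomena.PercolationContinuityZ3.Theorems.Transplant.HexShadowRouting
import HarnessLib

/-!
# HEXAGONAL SHADOWS XLVIII — THE ROUTING over a cleared vertex set: the local surgery at every good point of `U(ω)` from `ShapedLinkage`

builds on p205010 (kernel theorem, internal audit signed; external expert review pending) — NOT used in this file.  Lane `prim-bschramm`, seat
`prim-bschramm-p2` (gen 34; class C1b; memo `HOME/bschramm/P2-LATTICES.md` §125); helper file (`--supports stmt-CriticalPhenomena-4575 --as helper`).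
«HexShadowRouting» for the vertex-set surgery `HexShadow.VSurgery` and the instance node `HexShadow.ShapedLinkage Φ 3` («HexShadowVRouteData»):
* §1 vertex-set versions of the splitting lemmas: first/last visits of `γ_min` to a vertex set `W` (`γmin_split_atV`), the `src'`-side path `σ`
  (`exists_sigma_of_mem_UV`), and the honest `σ`-clip parameter `sR` (`sR_cast`);
* §2 **`exists_vsurgery_of_shapedLinkage`**: for data in range with `m ≥ 7`, a lattice configuration `ω ∈ 𝒳` and a point `z ∈ U(ω)` off `X₁`, `X₂`, `zBad`
  and not within `3` of the end of `γ_min(ω)`, a vertex-set surgery with `W ⊆ \overline{hexBall z 3}` exists — `W` is the instance's cleared set for the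
  block pair `(RP(z), D(z))`, `E₁, E₂` the first/last visits of `γ_min` to `W`, and the CERTIFIED TERMINAL DATA (`HexShadow.Terminals`: the
  `γ_min`-neighbours `o₁ → E₁ → a₁ ⋯ a₂ → E₂ → o₂`, their window position, distinctness along the self-avoiding `γ_min` whose middle piece passes over `z`,
  and `w'` off the columns of `γ_min`) is derived here once for all instances.
[cite: DuminilCopinSidoraviciusTassion2016, §2.3 (proof of Fact 2, pp. 6–7: u', v' first/last visits, w' and π, the three paths)] [cite: NewmanTassionWu2017, §3.2]
-/

noncomputable section

namespace Summit.CriticalPhenomena.PercolationContinuityZ3.Theorems.Transplant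

open MeasureTheory Literature.Probability.Percolation Literature.Probability.LatticeModels SimpleGraph Filter
open scoped Classical Topology

namespace HexShadow

variable {V : Type} {G : SimpleGraph V} {Φ : HexShadow G} [Countable V]

/-! ## §1 Splitting at a vertex set; the `src'`-side path; the `σ`-clip parameter -/

/-- **First and last visits of `γ_min` to a cleared VERTEX set** (vertex-set version of «HexShadowRoutePrep»'s `γmin_split_at`).
[cite: DuminilCopinSidoraviciusTassion2016, §2.3 (proof of Fact 2: "u' and v' … the first and last vertices of γ_min which are in B̄_R(z)")] -/
theorem γmin_split_atV (Γ : GlueData) {ω : BondConfig V} (hA : ω ∈ Φ.evA Γ) (W : Set V)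
    (hhead : ∀ h : Φ.γmin Γ ω ≠ [], (Φ.γmin Γ ω).head h ∉ W) (hlast : ∀ h : Φ.γmin Γ ω ≠ [], (Φ.γmin Γ ω).getLast h ∉ W)
    (htwo : ∃ a ∈ Φ.γmin Γ ω, ∃ b ∈ Φ.γmin Γ ω, a ≠ b ∧ a ∈ W ∧ b ∈ W) :
    ∃ (p₀ : List V) (E₁ : V) (mid : List V) (E₂ : V) (s₀ : List V),
      Φ.γmin Γ ω = p₀ ++ E₁ :: (mid ++ E₂ :: s₀) ∧ p₀ ≠ [] ∧ s₀ ≠ [] ∧ (∀ x ∈ p₀, x ∉ W) ∧ (∀ x ∈ s₀, x ∉ W) ∧ E₁ ∈ W ∧ E₂ ∈ W := by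
  obtain ⟨hγO, -⟩ := Φ.γmin_spec Γ hA
  set γ := Φ.γmin Γ ω with hγdef
  obtain ⟨a, haγ, b, hbγ, hab, haW, hbW⟩ := htwo
  obtain ⟨p₀, E₁, rest₁, hγ1, hE₁W, hp₀W⟩ := exists_first_split (p := fun x => x ∈ W) γ ⟨a, haγ, haW⟩
  have hp₀ : p₀ ≠ [] := by
    rintro rfl
    have h := hhead hγO.ne_nil
    simp only [hγ1, List.nil_append, List.head_cons] at h
    exact h hE₁W
  have hmeet : ∃ x ∈ rest₁, x ∈ W := by
    have key : ∀ {c : V}, c ∈ γ → c ∈ W → c ≠ E₁ → c ∈ rest₁ := by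
      intro c hc hcW hne
      rw [hγ1] at hc
      rcases List.mem_append.1 hc with h | h
      · exact absurd hcW (hp₀W c h)
      · rcases List.mem_cons.1 h with h | h
        · exact absurd h hne
        · exact h
    by_cases haE : a = E₁
    · exact ⟨b, key hbγ hbW (fun h => hab (haE.trans h.symm)), hbW⟩
    · exact ⟨a, key haγ haW haE, haW⟩
  obtain ⟨mid, E₂, s₀, hrest, hE₂W, hs₀W⟩ := exists_last_split (p := fun x => x ∈ W) rest₁ hmeet
  have hs₀ : s₀ ≠ [] := by
    rintro rfl
    have h := hlast hγO.ne_nil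
    have : γ.getLast hγO.ne_nil = E₂ := by
      simp only [hγ1, hrest]
      rw [List.getLast_append_of_ne_nil _ (List.cons_ne_nil _ _), List.getLast_cons (by simp), List.getLast_append_of_ne_nil _ (List.cons_ne_nil _ _)]
      simp
    rw [this] at h
    exact h hE₂W
  exact ⟨p₀, E₁, mid, E₂, s₀, by rw [hγ1, hrest], hp₀, hs₀, hp₀W, hs₀W, hE₁W, hE₂W⟩

/-- **The `src'`-side path `σ` from the `(P2)`-witness, for a vertex set `W` containing every vertex over `hexBall z 1 ∩ B'_n`.**
[cite: DuminilCopinSidoraviciusTassion2016, §2.3 (Definition of U(ω), (P2); proof of Fact 2, the path π)] -/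
theorem exists_sigma_of_mem_UV (Γ : GlueData) {ω : BondConfig V} {z : Site 2} (hz : z ∈ Φ.U Γ ω) {W : Set V}
    (hW : ∀ x : V, Φ.sh x ∈ hexBall z 1 → Φ.sh x ∈ Φ.small Γ → x ∈ W) :
    ∃ (w : V) (σ : List V), σ.head? = some w ∧ w ∈ W ∧ σ.IsChain (fun a b => s(a, b) ∈ ω ∧ a ≠ b) ∧ (∀ x ∈ σ, Φ.sh x ∈ Φ.small Γ) ∧
      (∀ x ∈ σ, Φ.sh x ∉ Φ.γcols Γ ω) ∧ (∀ x ∈ σ.tail, x ∉ W) ∧ ∀ h : σ ≠ [], σ.getLast h ∈ Φ.lift (Φ.src' Γ) := by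
  obtain ⟨-, -, x₀, hx₀, s', hs', hπ⟩ := hz
  obtain ⟨π, hπO⟩ := exists_openSAP_of_openConnIn hπ
  have hx₀π : π.head hπO.ne_nil = x₀ := hπO.head_mem hπO.ne_nil
  have hx₀mem : x₀ ∈ π := by rw [← hx₀π]; exact List.head_mem _
  have hx₀W : x₀ ∈ W := hW _ hx₀ (hπO.subset x₀ hx₀mem).1
  obtain ⟨l₁, w, σt, hsplit, hwW, hσt⟩ := exists_last_split (p := fun x => x ∈ W) π ⟨x₀, hx₀mem, hx₀W⟩
  refine ⟨w, w :: σt, rfl, hwW, ?_, ?_, ?_, ?_, ?_⟩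
  · have := hπO.chain
    rw [hsplit] at this
    exact (List.isChain_append.1 this).2.1
  · intro x hx
    exact (hπO.subset x (by rw [hsplit]; exact List.mem_append_right _ hx)).1
  · intro x hx
    exact (hπO.subset x (by rw [hsplit]; exact List.mem_append_right _ hx)).2
  · intro x hx
    exact hσt x hx
  · intro h
    have h1 : (w :: σt).getLast h = π.getLast hπO.ne_nil := by
      simp only [hsplit]
      rw [List.getLast_append_of_ne_nil _ (List.cons_ne_nil _ _)]
    rw [h1]
    have := hπO.last_mem hπO.ne_nil
    rw [Set.mem_singleton_iff] at this
    rw [this]; exact hs'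

omit [Countable V] in
/-- For `z ∈ B_{3n}` the `σ`-clip parameter of the rerouting block is the honest difference `6m − σ(z)`. [folklore] -/
theorem sR_cast {Γ : GlueData} {z : Site 2} (hzb : z ∈ Φ.big Γ) : ((Φ.sR Γ z : ℕ) : ℤ) = Φ.centre 0 + Φ.centre 1 + 6 * Γ.m - (z 0 + z 1) := by
  rw [mem_big_iff] at hzb; unfold sR; omega

omit [Countable V] in
/-- A point of `B_{3n}` lies in the window half-planes of the block of any `z ∈ B_{3n}`. [folklore] -/
theorem inWin_of_mem_big {Γ : GlueData} {z : Site 2} (hzb : z ∈ Φ.big Γ) {w : Site 2} (hw : w ∈ Φ.big Γ) :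
    HexShadow.InWin z (Φ.tD Γ z) (Φ.sR Γ z) w := by
  have ht := tD_cast (Φ := Φ) hzb
  have hs := sR_cast (Φ := Φ) hzb
  rw [mem_big_iff] at hw
  exact ⟨by omega, by omega⟩

/-! ## §2 The surgery at a good point of `U(ω)` -/

/-- **THE VERTEX-SET SURGERY EXISTS AT EVERY GOOD POINT OF `U(ω)`, given `ShapedLinkage`** (DST 2016, §2.3, proof of Fact 2: the construction of `ω^{(z)}`,
as the data `HexShadow.VSurgery` with cleared vertices `W ⊆ \overline{hexBall z 3}`).  `W` is the instance's cleared set for the block pair `(RP(z), D(z))`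
(between the lifts of `hexBall z 1 ∩ D(z)` and of `D(z)`); `E₁, E₂` are the first and last visits of `γ_min` to `W` (two distinct visits exist: the vertex over `z`
and its successor lie in `W`; the start over `S_{3n}` and the end are outside); the terminal data `Terminals` is certified from `γ_min` (its neighbours
`o₁, a₁, a₂, o₂` of `E₁, E₂`, inside the window, distinct by self-avoidance, `a₁ = a₂` only over `z`) and from the `(P2)`-witness (`w'` off the columns of
`γ_min`); the keyed routing comes from the swap pair; the key condition over `S_{3n}` is vacuous. [cite: DuminilCopinSidoraviciusTassion2016, §2.3, proof of Fact 2 (pp. 6–7)] -/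
theorem exists_vsurgery_of_shapedLinkage (hL : Φ.ShapedLinkage 3) {Γ : GlueData} (hΓ : Φ.InRange Γ) (hm : 7 ≤ Γ.m) {ω : BondConfig V}
    (hω : ω ⊆ G.edgeSet) (hX : ω ∈ Φ.evX Γ) {z : Site 2} (hz : z ∈ Φ.U Γ ω) (hX₁ : z ∉ Φ.X₁ Γ) (hX₂ : z ∉ Φ.X₂ Γ) (hzb : z ∉ Φ.zBad Γ)
    (hfar : ∀ v ∈ (Φ.γmin Γ ω).getLast?, z ∉ hexBall (Φ.sh v) 3) :
    ∃ sg : Φ.VSurgery Γ ω, sg.W ⊆ Φ.lift (hexBall z 3) := by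
  have hA : ω ∈ Φ.evA Γ := hX.1.1.1
  obtain ⟨hγO, -⟩ := Φ.γmin_spec Γ hA
  have hzU := hz
  obtain ⟨hzs, ⟨g, hgγ, hgz⟩, -⟩ := hz
  have hzbig : z ∈ Φ.big Γ := by rw [← hgz]; exact hγO.subset g hgγ
  have hadj : ∀ {a b : V}, s(a, b) ∈ ω → G.Adj a b := fun h => (SimpleGraph.mem_edgeSet G).1 (hω h)
  -- the instance's cleared set for the block pair `(RP(z), D(z))`
  obtain ⟨htRD, hsRD⟩ := tR_le_tD (Φ := Φ) Γ z
  obtain ⟨W, hWblk, hWin, hWlink⟩ := Φ.exists_W_of_shapedLinkage hL z htRD hsRD (three_le_tR_or_sR hX₂)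
  simp only [blkR_three] at hWblk hWin hWlink
  have hWD : ∀ x ∈ W, Φ.sh x ∈ Φ.Dblk Γ z := hWblk
  have hW3 : W ⊆ Φ.lift (hexBall z 3) := fun x hx => by rw [mem_lift]; exact Φ.Dblk_subset_hexBall Γ z (hWD x hx)
  have hWwin : W ⊆ Φ.lift (Φ.big Γ ∪ Φ.small Γ) := fun x hx => by
    rw [mem_lift]; exact Dblk_subset_window hΓ hm hzbig hzs hX₁ (hWD x hx)
  have hWbig : ∀ x : V, Φ.sh x ∈ hexBall z 1 → Φ.sh x ∈ Φ.big Γ → x ∈ W := fun x h1 hb =>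
    hWin x h1 (Φ.hexBall_inter_big_subset_Dblk Γ z (hexBall_mono z (by norm_num) h1) hb)
  have hWsmall : ∀ x : V, Φ.sh x ∈ hexBall z 1 → Φ.sh x ∈ Φ.small Γ → x ∈ W := fun x h1 hs =>
    hWin x h1 (Φ.hexBall_inter_small_subset_Dblk Γ z (hexBall_mono z (by norm_num) h1) hs)
  -- a vertex adjacent to a vertex over `z`, over `big`, lies in `W`
  have hnbW : ∀ {a b : V}, Φ.sh a = z → G.Adj a b → Φ.sh b ∈ Φ.big Γ → b ∈ W := by
    intro a b ha hab hb
    refine hWbig b ?_ hb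
    have hlip := Φ.lip hab
    rw [ha] at hlip
    exact mem_hexBall_comm.2 (by rw [mem_hexBall]; exact_mod_cast hlip)
  -- `g ∈ W`; the end and the start of `γ` are outside `W`
  have hz1 : z ∈ hexBall z 1 := by rw [mem_hexBall_iff_lin]; omega
  have hgW : g ∈ W := hWbig g (hgz.symm ▸ hz1) (hgz.symm ▸ hzbig)
  have hlastW : (Φ.γmin Γ ω).getLast hγO.ne_nil ∉ W := by
    intro h
    have := hfar ((Φ.γmin Γ ω).getLast hγO.ne_nil) (by rw [List.getLast?_eq_some_getLast hγO.ne_nil]; rfl)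
    have h3 := hW3 h
    rw [mem_lift] at h3
    exact this (mem_hexBall_comm.1 h3)
  have hheadW : ∀ h : Φ.γmin Γ ω ≠ [], (Φ.γmin Γ ω).head h ∉ W := by
    intro h hW
    exact Dblk_disjoint_src hΓ hm hzs (hWD _ hW) (hγO.head_mem h)
  have hzZ : z ∉ Φ.zSeg Γ := by
    intro hzZ
    have hg := Φ.eq_getLast_of_sh_mem_zSeg Γ hA hgγ (hgz.symm ▸ hzZ)
    exact hlastW (hg ▸ hgW)
  -- two distinct vertices of `γ` in `W`: `g` and its successor
  have htwo : ∃ a ∈ Φ.γmin Γ ω, ∃ b ∈ Φ.γmin Γ ω, a ≠ b ∧ a ∈ W ∧ b ∈ W := by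
    obtain ⟨l₁, l₂, hsplit⟩ := List.append_of_mem hgγ
    have hl₂ : l₂ ≠ [] := by
      rintro rfl
      have : (Φ.γmin Γ ω).getLast hγO.ne_nil = g := by simp only [hsplit, List.getLast_append_of_ne_nil _ (List.cons_ne_nil _ _), List.getLast_singleton]
      exact hlastW (this ▸ hgW)
    obtain ⟨u, l₂', rfl⟩ := List.exists_cons_of_ne_nil hl₂
    have hch := hγO.chain
    rw [hsplit, List.isChain_append] at hch
    have hgu : s(g, u) ∈ ω ∧ g ≠ u := (List.isChain_cons_cons.1 hch.2.1).1
    have huγ : u ∈ Φ.γmin Γ ω := by rw [hsplit]; simp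
    exact ⟨g, hgγ, u, huγ, hgu.2, hgW, hnbW hgz (hadj hgu.1) (hγO.subset u huγ)⟩
  -- the decomposition at the first and last visits
  obtain ⟨p₀, E₁, mid, E₂, s₀, hγeq, hp₀, hs₀, hp₀W, hs₀W, hE₁W, hE₂W⟩ := Φ.γmin_split_atV Γ hA W hheadW (fun h => hlastW) htwo
  have hnd := hγO.nodup
  rw [hγeq] at hnd
  have hE₁γ : E₁ ∈ Φ.γmin Γ ω := by rw [hγeq]; simp
  have hE₂γ : E₂ ∈ Φ.γmin Γ ω := by rw [hγeq]; simp
  have hE₁₂ : E₁ ≠ E₂ := by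
    intro h
    rw [List.nodup_append] at hnd
    have := (List.nodup_cons.1 hnd.2.1).1
    exact this (by rw [h]; simp)
  -- `E₁`, `E₂` are off `Z_n` (they are not the last vertex)
  have hE₁Z : Φ.sh E₁ ∉ Φ.zSeg Γ := fun hZ => hlastW (Φ.eq_getLast_of_sh_mem_zSeg Γ hA hE₁γ hZ ▸ hE₁W)
  have hE₂Z : Φ.sh E₂ ∉ Φ.zSeg Γ := fun hZ => hlastW (Φ.eq_getLast_of_sh_mem_zSeg Γ hA hE₂γ hZ ▸ hE₂W)
  have hE₁big : Φ.sh E₁ ∈ Φ.big Γ := hγO.subset E₁ hE₁γ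
  have hE₂big : Φ.sh E₂ ∈ Φ.big Γ := hγO.subset E₂ hE₂γ
  have hE₁RP : Φ.sh E₁ ∈ Φ.RPblk Γ z := mem_RPblk_of hzbig hzZ hzb (hWD _ hE₁W) hE₁big hE₁Z
  have hE₂RP : Φ.sh E₂ ∈ Φ.RPblk Γ z := mem_RPblk_of hzbig hzZ hzb (hWD _ hE₂W) hE₂big hE₂Z
  -- the neighbours of `E₁`, `E₂` along `γ`
  have hch := hγO.chain
  rw [hγeq, List.isChain_append] at hch
  set o₁ := p₀.getLast hp₀ with ho₁
  have ho₁E : s(o₁, E₁) ∈ ω := (hch.2.2 o₁ (by simp [ho₁, List.getLast?_eq_some_getLast hp₀]) E₁ (by simp)).1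
  have ho₁p₀ : o₁ ∈ p₀ := List.getLast_mem hp₀
  have ho₁γ : o₁ ∈ Φ.γmin Γ ω := by rw [hγeq]; exact List.mem_append_left _ ho₁p₀
  have ho₁W : o₁ ∉ W := hp₀W _ ho₁p₀
  set o₂ := s₀.head hs₀ with ho₂
  have h1 := hch.2.1
  rw [List.isChain_cons] at h1
  have h3 := List.isChain_append.1 (show (mid ++ E₂ :: s₀).IsChain _ from h1.2)
  have h4 := h3.2.1
  rw [List.isChain_cons] at h4
  have hE₂o : s(E₂, o₂) ∈ ω := (h4.1 o₂ (by simp [ho₂, List.head?_eq_some_head hs₀])).1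
  have ho₂s₀ : o₂ ∈ s₀ := List.head_mem hs₀
  have ho₂γ : o₂ ∈ Φ.γmin Γ ω := by rw [hγeq]; simp [ho₂s₀]
  have ho₂W : o₂ ∉ W := hs₀W _ ho₂s₀
  -- `E₁`, `E₂` are not over `z` (their outer neighbours are outside `W`), so `g ∈ mid` and `mid ≠ []`
  have hE₁z : Φ.sh E₁ ≠ z := fun h => ho₁W (hnbW h (hadj ho₁E).symm (hγO.subset o₁ ho₁γ))
  have hE₂z : Φ.sh E₂ ≠ z := fun h => ho₂W (hnbW h (hadj hE₂o) (hγO.subset o₂ ho₂γ))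
  have hgmid : g ∈ mid := by
    have hg := hgγ
    rw [hγeq] at hg
    rcases List.mem_append.1 hg with h | h
    · exact absurd hgW (hp₀W g h)
    rcases List.mem_cons.1 h with h | h
    · exact absurd (h ▸ hgz) hE₁z
    rcases List.mem_append.1 h with h | h
    · exact h
    rcases List.mem_cons.1 h with h | h
    · exact absurd (h ▸ hgz) hE₂z
    · exact absurd hgW (hs₀W g h)
  have hmid : mid ≠ [] := List.ne_nil_of_mem hgmid
  set a₁ := mid.head hmid with ha₁
  set a₂ := mid.getLast hmid with ha₂
  have ha₁mid : a₁ ∈ mid := List.head_mem hmid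
  have ha₂mid : a₂ ∈ mid := List.getLast_mem hmid
  have ha₁γ : a₁ ∈ Φ.γmin Γ ω := by rw [hγeq]; simp [ha₁mid]
  have ha₂γ : a₂ ∈ Φ.γmin Γ ω := by rw [hγeq]; simp [ha₂mid]
  have hE₁a : s(E₁, a₁) ∈ ω := (h1.1 a₁ (by rw [ha₁, List.head?_append, List.head?_eq_some_head hmid]; rfl)).1
  have ha₂E : s(a₂, E₂) ∈ ω := (h3.2.2 a₂ (by rw [ha₂, List.getLast?_eq_some_getLast hmid]; rfl) E₂ (by simp)).1
  -- distinctness along the self-avoiding `γ = p₀ ++ E₁ :: (mid ++ E₂ :: s₀)`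
  have hnd' := hnd
  rw [List.nodup_append] at hnd'
  obtain ⟨hp₀nd, hrestnd, hdisj⟩ := hnd'
  have hrest2 := (List.nodup_cons.1 hrestnd).2
  rw [List.nodup_append] at hrest2
  obtain ⟨hmidnd, hE₂s₀nd, hdisj2⟩ := hrest2
  have hE₁notin := (List.nodup_cons.1 hrestnd).1
  have ha₁o₁ : a₁ ≠ o₁ := fun h => hdisj o₁ ho₁p₀ a₁ (by simp [ha₁mid]) h.symm
  have ha₁E₂ : a₁ ≠ E₂ := fun h => hdisj2 a₁ ha₁mid E₂ (by simp) h
  have ha₂o₂ : a₂ ≠ o₂ := fun h => hdisj2 a₂ ha₂mid o₂ (by simp [ho₂s₀]) h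
  have ha₂E₁ : a₂ ≠ E₁ := fun h => hE₁notin (by rw [← h]; exact List.mem_append_left _ ha₂mid)
  have ho₁o₂ : o₁ ≠ o₂ := fun h => hdisj o₁ ho₁p₀ o₂ (by simp [ho₂s₀]) h
  have ho₁a₂ : o₁ ≠ a₂ := fun h => hdisj o₁ ho₁p₀ a₂ (by simp [ha₂mid]) h
  have ha₁o₂ : a₁ ≠ o₂ := fun h => hdisj2 a₁ ha₁mid o₂ (by simp [ho₂s₀]) h
  have ha₁a₂ : a₁ = a₂ → Φ.sh a₁ = z := by
    intro h
    -- `mid` is duplicate-free with `head = last`, so `mid = [a₁]` and `g = a₁`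
    obtain ⟨x, xs, hx⟩ := List.exists_cons_of_ne_nil hmid
    have hxs : xs = [] := by
      by_contra hne
      have hl : mid.getLast hmid = xs.getLast hne := by simp only [hx, List.getLast_cons hne]
      have hh : mid.head hmid = x := by simp only [hx, List.head_cons]
      have : x ∈ xs := by
        have := List.getLast_mem hne
        rw [← hl, ← ha₂, ← h, ha₁, hh] at this; exact this
      rw [hx] at hmidnd
      exact (List.nodup_cons.1 hmidnd).1 this
    subst hxs
    have hg' : g = x := by rw [hx] at hgmid; simpa using hgmid
    have : a₁ = x := by rw [ha₁]; simp only [hx, List.head_cons]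
    rw [this, ← hg']; exact hgz
  -- the `src'`-side path `σ` and `w'`
  obtain ⟨w', σ, hσhead, hw'W, hσchain, hσsmall, hσγ, hσW, hσsrc'⟩ := Φ.exists_sigma_of_mem_UV Γ hzU (W := W) hWsmall
  have hσne : σ ≠ [] := by rintro rfl; simp at hσhead
  have hw'σ : w' ∈ σ := by
    have : σ.head hσne = w' := by rw [List.head?_eq_some_head hσne, Option.some.injEq] at hσhead; exact hσhead
    rw [← this]; exact List.head_mem _
  have hw'γ : Φ.sh w' ∉ Φ.γcols Γ ω := hσγ w' hw'σ
  have hoff : ∀ {x : V}, x ∈ Φ.γmin Γ ω → Φ.sh w' ≠ Φ.sh x := fun {x} hx h => hw'γ ⟨x, hx, h.symm⟩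
  -- the certified terminal data and the routing
  have hT : Φ.Terminals 3 z (Φ.tR Γ z) (Φ.tD Γ z) (Φ.sR Γ z) W E₁ E₂ w' :=
    { ne := hE₁₂, E₁W := hE₁W, E₂W := hE₂W, E₁R := hE₁RP, E₂R := hE₂RP, E₁z := hE₁z, E₂z := hE₂z, w'W := hw'W,
      w'z := fun h => hw'γ ⟨g, hgγ, hgz.trans h.symm⟩, w'E₁ := hoff hE₁γ, w'E₂ := hoff hE₂γ,
      nbrs := ⟨o₁, a₁, a₂, o₂, hadj ho₁E, hadj hE₁a, hadj ha₂E, hadj hE₂o, ho₁W, ho₂W,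
        inWin_of_mem_big hzbig (hγO.subset o₁ ho₁γ), inWin_of_mem_big hzbig (hγO.subset a₁ ha₁γ),
        inWin_of_mem_big hzbig (hγO.subset a₂ ha₂γ), inWin_of_mem_big hzbig (hγO.subset o₂ ho₂γ),
        ha₁o₁, ha₁E₂, ha₂o₂, ha₂E₁, ho₁o₂, ho₁a₂, ha₁o₂, ha₁a₂, hoff ho₁γ, hoff ha₁γ, hoff ha₂γ, hoff ho₂γ⟩ }
  obtain ⟨r, hkey⟩ := hWlink E₁ E₂ w' hT
  have hRPbig : Φ.RPblk Γ z ⊆ Φ.big Γ := RPblk_subset_big hΓ hm hzbig hzs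
  have hPRP : ∀ x ∈ r.P, Φ.sh x ∈ Φ.RPblk Γ z := fun x hx => by have := (r.hP x hx).2; rwa [mem_lift] at this
  refine ⟨⟨W, p₀, E₁, mid, E₂, s₀, r.P, r.c, r.Br, σ, hWwin, hγeq, hp₀, hs₀, hp₀W, hs₀W, hE₁W, hE₂W,
    fun x hx => (r.hP x hx).1, fun x hx => hRPbig (hPRP x hx), fun x hx => RPblk_disjoint_zSeg hzbig hzZ hzb (hPRP x hx),
    r.hchain, r.hnodup, r.c_mem, r.hBr, r.hBrW, r.hBrchain, r.hBrnodup, r.hBrSP, r.hfwd_of_key hkey, ?_, by rw [r.hBrlast]; exact hσhead,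
    hσchain, hσsmall, hσγ, hσW, hσsrc'⟩, hW3⟩
  -- no structure vertex over `S_{3n}`
  intro v hv hvsrc _
  rw [mem_lift] at hvsrc
  rcases List.mem_append.1 hv with h | h
  · exact absurd hvsrc (Dblk_disjoint_src hΓ hm hzs (hWD v (r.hP v h).1))
  · exact absurd hvsrc (Dblk_disjoint_src hΓ hm hzs (hWD v (r.hBrW v (List.dropLast_subset _ h))))

end HexShadow

end Summit.CriticalPhenomena.PercolationContinuityZ3.Theorems.Transplant

end
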